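import Summits.FinalStateConjecture.FinalStateConjecture.Theorems.PhaseMixingCaptureBulkKerrCaptureC2CentreGaugeAdmissible
import Mathlib.Analysis.Calculus.ContDiff.Comp
import Mathlib.Topology.Order.Compact
import HarnessLib

/-!
# Crux `PhaseMixingCapture.BulkKerrCaptureC2` (stmt-FinalStateConjecture-14985): smooth compactly supported
# one-parameter families are continuous at the centre in EVERY weighted Sobolev distance

Support file (analysis core of the `ε`-ball membership of the gauge orbit of the centre; sequel of
`PhaseMixingCaptureBulkKerrCaptureC2CentreGaugeAdmissible.lean`).  The crux types "data `ε`-close to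
`Kerr.data M a M`" by the weighted Sobolev distance `dataWeightedSobolevEDist s δ` (`H^s_δ × H^{s-1}_{δ+1}` of the
junk-extended component differences).  To place explicit competitors in a given `ε`-ball one needs a
soft continuity statement, proved here in full generality:

* `contDiff_iteratedFDeriv_family` — for a jointly smooth family `f : ℝ → F → G`, the parametric iterated
  derivatives `(t, x) ↦ D^m_x (f t)(x)` are jointly smooth (induction on `m` with `ContDiff.fderiv`);
* `tendsto_sSup_image_norm` — a jointly continuous family vanishing at `t = 0` tends to `0` uniformly on a
  compact set (`IsCompact.continuous_sSup`);
* `tendsto_lintegral_weight_family`, `tendsto_weightedSobolevSeminorm_family` — **if `f` is jointly smooth,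
  `f 0 = 0`, and every `f t` is supported in a fixed compact set `K`, then `‖f t‖_{H^s_δ(U)} → 0` as `t → 0`**
  for every set `U`, order `s` and weight `δ` (bound each weighted `L²` term by
  `sup_K (1+‖x‖)^{2(δ+m)} · (sup_K ‖D^m f t‖)² · vol K`);
* `tendsto_dataWeightedSobolevEDist_family`, `eventually_dataWeightedSobolevEDist_lt` — the same for a
  family of initial data sets on an open `U ⊆ ℝ³` whose component differences to a fixed datum are such
  families: the distance tends to `0`, so the family is eventually inside every `ε`-ball, at every order
  and weight.

References: R. Bartnik, CPAM 39 (1986), §1 (weighted Sobolev classes `W^{k,p}_δ`, `C^∞_c` dense);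
Y. Choquet-Bruhat, D. Christodoulou, Acta Math. 146 (1981), §2 (the `H_{s,δ}` spaces).
-/

-- the doubled `FinalStateConjecture.FinalStateConjecture` path component trips dupNamespace
set_option linter.dupNamespace false

noncomputable section

open Set Filter Function Topology MeasureTheory TopologicalSpace
open scoped Manifold ContDiff Topology
open Literature.Geometry.Lorentzian

namespace Summit.FinalStateConjecture.FinalStateConjecture.Theorems.BulkKerrCaptureC2.Centre

/-! ## §1 Parametric iterated derivatives and uniform smallness on compact sets -/

section FamilyCalculus

variable {F G : Type*} [NormedAddCommGroup F] [NormedSpace ℝ F] [NormedAddCommGroup G]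
  [NormedSpace ℝ G]

/-- **Parametric iterated derivatives of a jointly smooth family are jointly smooth**:
if `(t, x) ↦ f t x` is `C^∞` then so is `(t, x) ↦ D^m (f t)(x)` for every `m` (induction: `D^{m+1}` is a
currying isometry composed with the `x`-derivative of `D^m`, and the derivative of a jointly smooth
family in one variable is jointly smooth, `ContDiff.fderiv`). [folklore] -/
theorem contDiff_iteratedFDeriv_family {f : ℝ → F → G} (hf : ContDiff ℝ ∞ (uncurry f)) (m : ℕ) :
    ContDiff ℝ ∞ fun p : ℝ × F ↦ iteratedFDeriv ℝ m (f p.1) p.2 := by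
  induction m with
  | zero =>
    simp_rw [iteratedFDeriv_zero_eq_comp]
    exact (continuousMultilinearCurryFin0 ℝ F G).symm.contDiff.comp hf
  | succ m ih =>
    simp_rw [iteratedFDeriv_succ_eq_comp_left]
    have h2 : ContDiff ℝ ∞ (uncurry fun (p : ℝ × F) (y : F) ↦ iteratedFDeriv ℝ m (f p.1) y) :=
      ih.comp (contDiff_fst.fst.prodMk contDiff_snd)
    exact (h2.fderiv (contDiff_snd (n := ∞)) (le_of_eq (by rfl))).continuousLinearMap_comp
      ((continuousMultilinearCurryLeftEquiv ℝ (fun _ : Fin (m + 1) ↦ F) G).symm :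
        _ →L[ℝ] F [×(m + 1)]→L[ℝ] G)

omit [NormedSpace ℝ F] in
/-- **A jointly continuous family vanishing at `t = 0` is uniformly small on a compact set**:
`sup_{x ∈ K} ‖Ψ t x‖ → 0` as `t → 0` (the supremum is a continuous function of `t`,
`IsCompact.continuous_sSup`, vanishing at `0`). [folklore] -/
theorem tendsto_sSup_image_norm {H : Type*} [NormedAddCommGroup H] {Ψ : ℝ → F → H}
    (hΨ : Continuous (uncurry Ψ)) {K : Set F} (hK : IsCompact K) (h0 : ∀ x, Ψ 0 x = 0) :
    Tendsto (fun t ↦ sSup ((fun x ↦ ‖Ψ t x‖) '' K)) (𝓝 0) (𝓝 0) := by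
  have hc : Continuous fun t ↦ sSup ((fun x ↦ ‖Ψ t x‖) '' K) :=
    hK.continuous_sSup (f := fun t x ↦ ‖Ψ t x‖) hΨ.norm
  have h0' : sSup ((fun x ↦ ‖Ψ 0 x‖) '' K) = 0 := by
    rcases K.eq_empty_or_nonempty with rfl | hne
    · simp
    · have himg : (fun x ↦ ‖Ψ 0 x‖) '' K = {0} := by
        rw [show (fun x ↦ ‖Ψ 0 x‖) = fun _ : F ↦ (0 : ℝ) from funext fun x ↦ by rw [h0, norm_zero]]
        exact hne.image_const 0
      rw [himg, csSup_singleton]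
  simpa [h0'] using hc.tendsto 0

omit [NormedSpace ℝ F] in
/-- Pointwise bound by the supremum over a compact set, for a jointly continuous family.
[folklore] -/
theorem norm_le_sSup_image_norm {H : Type*} [NormedAddCommGroup H] {Ψ : ℝ → F → H}
    (hΨ : Continuous (uncurry Ψ)) {K : Set F} (hK : IsCompact K) (t : ℝ) {x : F} (hx : x ∈ K) :
    ‖Ψ t x‖ ≤ sSup ((fun x ↦ ‖Ψ t x‖) '' K) := by
  have hct : Continuous fun x ↦ ‖Ψ t x‖ := (hΨ.comp (Continuous.prodMk_right t)).norm
  exact le_csSup (hK.image hct).bddAbove ⟨x, hx, rfl⟩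

end FamilyCalculus

/-! ## §2 Compactly supported smooth families tend to `0` in every weighted Sobolev seminorm -/

section FamilySeminorm

variable {F G : Type*} [NormedAddCommGroup F] [NormedSpace ℝ F] [MeasureSpace F]
  [OpensMeasurableSpace F] [IsFiniteMeasureOnCompacts (volume : Measure F)]
  [NormedAddCommGroup G] [NormedSpace ℝ G]

/-- **Each weighted `L²` term tends to `0`**: for a jointly smooth family `f` with `f 0 = 0` and all
`f t` supported in the compact `K`,
`∫_U (1+‖x‖)^p ‖D^m (f t)(x)‖² dx ≤ sup_K (1+‖x‖)^p · (sup_K ‖D^m (f t)‖)² · vol K → 0` as `t → 0`.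
Bartnik 1986, §1. [folklore] -/
theorem tendsto_lintegral_weight_family {f : ℝ → F → G} (hf : ContDiff ℝ ∞ (uncurry f))
    {K : Set F} (hK : IsCompact K) (hsupp : ∀ t, support (f t) ⊆ K) (h0 : ∀ x, f 0 x = 0)
    (U : Set F) (p : ℝ) (m : ℕ) :
    Tendsto (fun t ↦ ∫⁻ x in U,
      ENNReal.ofReal ((1 + ‖x‖) ^ p * ‖iteratedFDeriv ℝ m (f t) x‖ ^ 2)) (𝓝 0) (𝓝 0) := by
  set Ψ : ℝ → F → (F [×m]→L[ℝ] G) := fun t x ↦ iteratedFDeriv ℝ m (f t) x with hΨ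
  have hΨc : Continuous (uncurry Ψ) := (contDiff_iteratedFDeriv_family hf m).continuous
  have hΨ0 : ∀ x, Ψ 0 x = 0 := by
    intro x
    have hf0 : f 0 = 0 := funext h0
    simp [hΨ, hf0]
  set S : ℝ → ℝ := fun t ↦ sSup ((fun x ↦ ‖Ψ t x‖) '' K) with hS_def
  have hS : Tendsto S (𝓝 0) (𝓝 0) := tendsto_sSup_image_norm hΨc hK hΨ0
  have hwc : Continuous fun x : F ↦ (1 + ‖x‖) ^ p :=
    (continuous_const.add continuous_norm).rpow_const fun x ↦
      Or.inl (add_pos_of_pos_of_nonneg one_pos (norm_nonneg x)).ne'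
  set W : ℝ := sSup ((fun x : F ↦ (1 + ‖x‖) ^ p) '' K) with hW_def
  -- pointwise bound by a constant on `K`, zero off `K`
  have hbound : ∀ t x, ENNReal.ofReal ((1 + ‖x‖) ^ p * ‖Ψ t x‖ ^ 2) ≤
      K.indicator (fun _ ↦ ENNReal.ofReal (W * S t ^ 2)) x := by
    intro t x
    by_cases hx : x ∈ K
    · rw [indicator_of_mem hx]
      refine ENNReal.ofReal_le_ofReal ?_
      have hw0 : 0 ≤ (1 + ‖x‖) ^ p := Real.rpow_nonneg (by positivity) _
      have hw : (1 + ‖x‖) ^ p ≤ W := le_csSup (hK.image hwc).bddAbove ⟨x, hx, rfl⟩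
      have hs : ‖Ψ t x‖ ≤ S t := norm_le_sSup_image_norm hΨc hK t hx
      exact mul_le_mul hw (pow_le_pow_left₀ (norm_nonneg _) hs 2) (sq_nonneg _) (hw0.trans hw)
    · rw [indicator_of_notMem hx]
      have hzero : Ψ t x = 0 := by
        by_contra hne
        have hxK : x ∈ tsupport (f t) := support_iteratedFDeriv_subset m (mem_support.2 hne)
        exact hx (closure_minimal (hsupp t) hK.isClosed hxK)
      simp [hzero]
  have hint : ∀ t, ∫⁻ x in U, ENNReal.ofReal ((1 + ‖x‖) ^ p * ‖Ψ t x‖ ^ 2) ≤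
      ENNReal.ofReal (W * S t ^ 2) * volume K := fun t ↦
    calc ∫⁻ x in U, ENNReal.ofReal ((1 + ‖x‖) ^ p * ‖Ψ t x‖ ^ 2)
        ≤ ∫⁻ x, ENNReal.ofReal ((1 + ‖x‖) ^ p * ‖Ψ t x‖ ^ 2) := setLIntegral_le_lintegral U _
      _ ≤ ∫⁻ x, K.indicator (fun _ ↦ ENNReal.ofReal (W * S t ^ 2)) x := lintegral_mono (hbound t)
      _ = ENNReal.ofReal (W * S t ^ 2) * volume K := lintegral_indicator_const hK.measurableSet _
  have hlim : Tendsto (fun t ↦ ENNReal.ofReal (W * S t ^ 2) * volume K) (𝓝 0) (𝓝 0) := by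
    have h1 : Tendsto (fun t ↦ W * S t ^ 2) (𝓝 0) (𝓝 0) := by
      simpa using (hS.pow 2).const_mul W
    have h2 : Tendsto (fun t ↦ ENNReal.ofReal (W * S t ^ 2)) (𝓝 0) (𝓝 0) := by
      simpa using ENNReal.tendsto_ofReal h1
    simpa using ENNReal.Tendsto.mul_const h2 (Or.inr hK.measure_lt_top.ne)
  exact tendsto_of_tendsto_of_tendsto_of_le_of_le tendsto_const_nhds hlim (fun t ↦ bot_le) hint

/-- **Compactly supported smooth families tend to `0` in every weighted Sobolev seminorm**: if
`(t, x) ↦ f t x` is `C^∞`, `f 0 = 0`, and every `f t` is supported in a fixed compact set, then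
`‖f t‖_{H^s_δ(U)} → 0` as `t → 0`, for every `U`, `s`, `δ`. Bartnik 1986, §1. [folklore] -/
theorem tendsto_weightedSobolevSeminorm_family {f : ℝ → F → G} (hf : ContDiff ℝ ∞ (uncurry f))
    {K : Set F} (hK : IsCompact K) (hsupp : ∀ t, support (f t) ⊆ K) (h0 : ∀ x, f 0 x = 0)
    (U : Set F) (s : ℕ) (δ : ℝ) :
    Tendsto (fun t ↦ weightedSobolevSeminorm U s δ (f t)) (𝓝 0) (𝓝 0) := by
  unfold weightedSobolevSeminorm
  have hsum : Tendsto (fun t ↦ ∑ m ∈ Finset.range (s + 1), ∫⁻ x in U,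
      ENNReal.ofReal ((1 + ‖x‖) ^ (2 * (δ + m) : ℝ) * ‖iteratedFDeriv ℝ m (f t) x‖ ^ 2))
      (𝓝 0) (𝓝 0) := by
    have h := tendsto_finsetSum (Finset.range (s + 1))
      (fun m _ ↦ tendsto_lintegral_weight_family hf hK hsupp h0 U (2 * (δ + m)) m)
    simpa using h
  have hr : Tendsto (fun z : ENNReal ↦ z ^ (1 / 2 : ℝ)) (𝓝 0) (𝓝 0) := by
    have h := (ENNReal.continuous_rpow_const (y := (1 / 2 : ℝ))).tendsto 0
    simpa [ENNReal.zero_rpow_of_pos (by norm_num : (0 : ℝ) < 1 / 2)] using h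
  exact hr.comp hsum

end FamilySeminorm

/-! ## §3 Families of initial data sets on an open `U ⊆ ℝ³` -/

section DataFamily

variable {U : Opens E3}

/-- **A one-parameter family of initial data sets is continuous at `t = 0` in every weighted Sobolev
distance** `H^s_δ × H^{s-1}_{δ+1}`, provided its (junk-extended) component differences to the datum at
`t = 0` are jointly smooth on `ℝ × ℝ³` and supported in a fixed compact set: the distance tends to
`0` as `t → 0`, for every order `s` and weight `δ`. Bartnik 1986, §1. [folklore] -/
theorem tendsto_dataWeightedSobolevEDist_family (D : ℝ → InitialDataSet 𝓘(ℝ, E3) U)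
    (D₀ : InitialDataSet 𝓘(ℝ, E3) U)
    (hh : ContDiff ℝ ∞ (uncurry fun t y ↦ (D t).hFun y - D₀.hFun y))
    (hk : ContDiff ℝ ∞ (uncurry fun t y ↦ (D t).kFun y - D₀.kFun y))
    {K : Set E3} (hK : IsCompact K) (hhs : ∀ t, support ((D t).hFun - D₀.hFun) ⊆ K)
    (hks : ∀ t, support ((D t).kFun - D₀.kFun) ⊆ K) (h0 : D 0 = D₀) (s : ℕ) (δ : ℝ) :
    Tendsto (fun t ↦ InitialDataSet.dataWeightedSobolevEDist s δ (D t) D₀) (𝓝 0) (𝓝 0) := by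
  have h0h : ∀ y, ((D 0).hFun - D₀.hFun) y = 0 := fun y ↦ by
    rw [h0, Pi.sub_apply]
    exact sub_self (D₀.hFun y)
  have h0k : ∀ y, ((D 0).kFun - D₀.kFun) y = 0 := fun y ↦ by
    rw [h0, Pi.sub_apply]
    exact sub_self (D₀.kFun y)
  have h1 := tendsto_weightedSobolevSeminorm_family (f := fun t ↦ (D t).hFun - D₀.hFun) hh hK hhs
    h0h (U : Set E3) s δ
  have h2 := tendsto_weightedSobolevSeminorm_family (f := fun t ↦ (D t).kFun - D₀.kFun) hk hK hks
    h0k (U : Set E3) (s - 1) (δ + 1)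
  unfold InitialDataSet.dataWeightedSobolevEDist
  simpa using h1.add h2

/-- **Such a family is eventually inside every `ε`-ball about the datum at `t = 0`**, at every order
and weight. [folklore] -/
theorem eventually_dataWeightedSobolevEDist_lt (D : ℝ → InitialDataSet 𝓘(ℝ, E3) U)
    (D₀ : InitialDataSet 𝓘(ℝ, E3) U)
    (hh : ContDiff ℝ ∞ (uncurry fun t y ↦ (D t).hFun y - D₀.hFun y))
    (hk : ContDiff ℝ ∞ (uncurry fun t y ↦ (D t).kFun y - D₀.kFun y))
    {K : Set E3} (hK : IsCompact K) (hhs : ∀ t, support ((D t).hFun - D₀.hFun) ⊆ K)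
    (hks : ∀ t, support ((D t).kFun - D₀.kFun) ⊆ K) (h0 : D 0 = D₀) (s : ℕ) (δ : ℝ)
    {ε : ℝ} (hε : 0 < ε) :
    ∀ᶠ t in 𝓝 (0 : ℝ),
      InitialDataSet.dataWeightedSobolevEDist s δ (D t) D₀ < ENNReal.ofReal ε :=
  (tendsto_dataWeightedSobolevEDist_family D D₀ hh hk hK hhs hks h0 s δ).eventually
    (Iio_mem_nhds (ENNReal.ofReal_pos.2 hε))

end DataFamily


/-- Registered stub `stub_sobolevFamilyLimit` of the crux item (verbatim signature): the statement of
`eventually_dataWeightedSobolevEDist_lt` with all binders explicit. [folklore] -/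
theorem stub_sobolevFamilyLimit : ∀ (U : TopologicalSpace.Opens E3) (D : ℝ → InitialDataSet 𝓘(ℝ, E3) U) (D₀ : InitialDataSet 𝓘(ℝ, E3) U), ContDiff ℝ ∞ (Function.uncurry fun t y ↦ (D t).hFun y - D₀.hFun y) → ContDiff ℝ ∞ (Function.uncurry fun t y ↦ (D t).kFun y - D₀.kFun y) → ∀ (K : Set E3), IsCompact K → (∀ t, Function.support ((D t).hFun - D₀.hFun) ⊆ K) → (∀ t, Function.support ((D t).kFun - D₀.kFun) ⊆ K) → D 0 = D₀ → ∀ (s : ℕ) (δ ε : ℝ), 0 < ε → ∀ᶠ t in nhds (0 : ℝ), InitialDataSet.dataWeightedSobolevEDist s δ (D t) D₀ < ENNReal.ofReal ε :=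
  fun _ D D₀ hh hk _ hK hhs hks h0 s δ _ hε ↦
    eventually_dataWeightedSobolevEDist_lt D D₀ hh hk hK hhs hks h0 s δ hε

end Summit.FinalStateConjecture.FinalStateConjecture.Theorems.BulkKerrCaptureC2.Centre
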